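import Literature.Probability.LatticeModels.CoarseCellMixingDefectsBlockLeak
import Literature.Probability.LatticeModels.CoarseCellMixingDLR
import HarnessLib

/-!
# Coarse-cell mixing with defects: blocks of cells and exact block locality

Companion ("theorems only" plus three bookkeeping definitions) file of the coarse-cell defect
series. An expansion around bad clusters resamples, inside a cell-union volume `Λ`, the sites of
`Λ` lying in a finite set of CELLS (a fattened cluster); this file fixes that bookkeeping and the
exact locality of block kernels in the block-Markov case `HasBlockLeak cell γ 0 r`:

* `cellsOf cell Λ` — the cells meeting `Λ`; `sitesIn cell Λ C` — the sites of `Λ` whose cell lies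
  in `C` (a cell-union inside `Λ` when `Λ` is one); `fatten C K t` — the cells of `C` within
  coarse distance `t` of a cell of `K`;
* `kernel_integral_eq_of_hasBlockLeak_zero` — for `HasBlockLeak cell γ 0 r` (amplitude `0`:
  block-Markov at the cell scale), the kernel expectation `γ_A f(σ)` of an observable reading `A`
  and agreeing sites does not change when `σ` is modified off the sites whose cell is within
  distance `1` of a cell of `A` (the hypothesis' agreement requirement on `A` itself is immaterial,
  `DobrushinShlosman.spec_apply_congr`).

## References

* H.-O. Georgii, *Gibbs Measures and Phase Transitions* (2011), Def. 1.23, Ch. 8.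
-/

noncomputable section

open _root_.MeasureTheory
open scoped ENNReal

namespace Literature.Probability.LatticeModels

variable {d : ℕ} {μc : Fin d → ℕ} {V S : Type*}

/-! ### Cells of a volume, sites of a set of cells, fattening -/

section Blocks

variable (cell : V → CoarseIdx μc)

/-- The cells meeting the volume `Λ`. [folklore] -/
def cellsOf (Λ : Finset V) : Finset (CoarseIdx μc) :=
  Finset.univ.filter fun c => ∃ v ∈ Λ, cell v = c

/-- The sites of `Λ` whose cell lies in the cell set `C`. [folklore] -/
def sitesIn (Λ : Finset V) (C : Finset (CoarseIdx μc)) : Finset V :=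
  Λ.filter fun v => cell v ∈ C

/-- The cells of `C` within coarse distance `t` of a cell of `K`. [folklore] -/
def fatten (C K : Finset (CoarseIdx μc)) (t : ℕ) : Finset (CoarseIdx μc) :=
  C.filter fun c => ∃ k ∈ K, cdist k c ≤ t

variable {cell}

/-- Membership in `cellsOf`. [folklore] -/
theorem mem_cellsOf {Λ : Finset V} {c : CoarseIdx μc} : c ∈ cellsOf cell Λ ↔ ∃ v ∈ Λ, cell v = c := by
  simp [cellsOf]

/-- Membership in `sitesIn`. [folklore] -/
theorem mem_sitesIn {Λ : Finset V} {C : Finset (CoarseIdx μc)} {v : V} :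
    v ∈ sitesIn cell Λ C ↔ v ∈ Λ ∧ cell v ∈ C := by
  simp [sitesIn]

/-- Membership in `fatten`. [folklore] -/
theorem mem_fatten {C K : Finset (CoarseIdx μc)} {t : ℕ} {c : CoarseIdx μc} :
    c ∈ fatten C K t ↔ c ∈ C ∧ ∃ k ∈ K, cdist k c ≤ t := by
  simp [fatten]

/-- `sitesIn Λ C ⊆ Λ`. [folklore] -/
theorem sitesIn_subset (Λ : Finset V) (C : Finset (CoarseIdx μc)) : sitesIn cell Λ C ⊆ Λ :=
  Finset.filter_subset _ _

/-- `sitesIn Λ C` is a cell-union when `Λ` is. [folklore] -/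
theorem sitesIn_cellUnion {Λ : Finset V} (hΛ : ∀ v w, cell v = cell w → v ∈ Λ → w ∈ Λ)
    (C : Finset (CoarseIdx μc)) : ∀ v w, cell v = cell w → v ∈ sitesIn cell Λ C → w ∈ sitesIn cell Λ C := by
  intro v w hvw hv
  rw [mem_sitesIn] at hv ⊢
  exact ⟨hΛ v w hvw hv.1, hvw ▸ hv.2⟩

/-- A cell of `C` meeting the cell-union `Λ` has all its sites in `sitesIn Λ C`. [folklore] -/
theorem mem_sitesIn_of_mem {Λ : Finset V} (hΛ : ∀ v w, cell v = cell w → v ∈ Λ → w ∈ Λ)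
    {C : Finset (CoarseIdx μc)} {c : CoarseIdx μc} (hc : c ∈ C) (hcΛ : c ∈ cellsOf cell Λ) :
    ∀ v, cell v = c → v ∈ sitesIn cell Λ C := by
  intro v hv
  obtain ⟨w, hw, hwc⟩ := mem_cellsOf.1 hcΛ
  exact mem_sitesIn.2 ⟨hΛ w v (hwc.trans hv.symm) hw, hv ▸ hc⟩

/-- In a cell-union `Λ`, a cell meeting `Λ` has all its sites in `Λ`. [folklore] -/
theorem mem_of_mem_cellsOf {Λ : Finset V} (hΛ : ∀ v w, cell v = cell w → v ∈ Λ → w ∈ Λ)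
    {c : CoarseIdx μc} (hc : c ∈ cellsOf cell Λ) : ∀ v, cell v = c → v ∈ Λ := by
  intro v hv
  obtain ⟨w, hw, hwc⟩ := mem_cellsOf.1 hc
  exact hΛ w v (hwc.trans hv.symm) hw

/-- A site off the cell-union `Λ` has its cell off `cellsOf Λ`. [folklore] -/
theorem cell_notMem_cellsOf {Λ : Finset V} (hΛ : ∀ v w, cell v = cell w → v ∈ Λ → w ∈ Λ) {v : V}
    (hv : v ∉ Λ) : cell v ∉ cellsOf cell Λ := fun h =>
  hv (mem_of_mem_cellsOf hΛ h v rfl)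

/-- `fatten C K t ⊆ C`. [folklore] -/
theorem fatten_subset (C K : Finset (CoarseIdx μc)) (t : ℕ) : fatten C K t ⊆ C :=
  Finset.filter_subset _ _

/-- `K ∩ C ⊆ fatten C K t`. [folklore] -/
theorem subset_fatten {C K : Finset (CoarseIdx μc)} (hKC : K ⊆ C) (t : ℕ) : K ⊆ fatten C K t :=
  fun k hk => mem_fatten.2 ⟨hKC hk, k, hk, by rw [cdist_self]; exact Nat.zero_le _⟩

/-- The fattening of `K` has at most `(2t+1)^d |K|` cells. [folklore] -/
theorem card_fatten_le (C K : Finset (CoarseIdx μc)) (t : ℕ) :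
    (fatten C K t).card ≤ (2 * t + 1) ^ d * K.card := by
  classical
  have h1 : fatten C K t ⊆ K.biUnion fun k => Finset.univ.filter fun c : CoarseIdx μc => cdist k c ≤ t := by
    intro c hc
    obtain ⟨-, k, hk, hkc⟩ := mem_fatten.1 hc
    exact Finset.mem_biUnion.2 ⟨k, hk, Finset.mem_filter.2 ⟨Finset.mem_univ _, hkc⟩⟩
  refine (Finset.card_le_card h1).trans (Finset.card_biUnion_le.trans ?_)
  calc ∑ k ∈ K, (Finset.univ.filter fun c : CoarseIdx μc => cdist k c ≤ t).card
      ≤ ∑ _k ∈ K, (2 * t + 1) ^ d := Finset.sum_le_sum fun k _ => card_filter_cdist_le k t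
    _ = (2 * t + 1) ^ d * K.card := by rw [Finset.sum_const, smul_eq_mul, mul_comm]

end Blocks

/-! ### Exact block locality in the block-Markov case -/

section Markov

variable [MeasurableSpace S] [Fintype V] {cell : V → CoarseIdx μc} {γ : Specification V S}

/-- **Exact locality of block kernels for `HasBlockLeak cell γ 0 r`.** If the amplitude of the
block leak vanishes, then for a cell-union `A`, two exteriors `σ, σ'` agreeing on every site OFF
`A` whose cell is within coarse distance `1` of a cell of `A`, and a measurable `[0,1]`-valued `f`
reading only `A` and agreeing sites, `γ_A f(σ) = γ_A f(σ')` (modify `σ'` on `A` to agree with `σ`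
there — immaterial for the kernel — and use the two ratio bounds with factor `e^0 = 1`).
[cite: Georgii2011, Def. 1.23] -/
theorem kernel_integral_eq_of_hasBlockLeak_zero (hγ : IsSpecification γ) {r : ℝ}
    (hBL : HasBlockLeak cell γ 0 r) (A : Finset V) (hA : ∀ v w, cell v = cell w → v ∈ A → w ∈ A)
    (σ σ' : V → S)
    (hagree : ∀ v, v ∉ A → (∃ w ∈ A, cdist (cell w) (cell v) ≤ 1) → σ v = σ' v)
    {f : (V → S) → ℝ} (hf : Measurable f) (hf01 : ∀ τ, 0 ≤ f τ ∧ f τ ≤ 1)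
    (hdep : DependsOn f {v | v ∈ A ∨ σ v = σ' v}) :
    ∫ τ, f τ ∂(γ A σ) = ∫ τ, f τ ∂(γ A σ') := by
  classical
  -- `σ'` modified on `A`
  let σ'' : V → S := fun v => if v ∈ A then σ v else σ' v
  have hker : γ A σ'' = γ A σ' :=
    DobrushinShlosman.spec_apply_congr hγ A fun v hv => by simp only [σ'', hv, if_false]
  have hagree' : ∀ v, (∃ w ∈ A, cdist (cell w) (cell v) ≤ 0 + 1) → σ v = σ'' v := by
    intro v hv
    by_cases hvA : v ∈ A
    · simp only [σ'', hvA, if_true]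
    · simp only [σ'', hvA, if_false]
      exact hagree v hvA (by simpa using hv)
  have hdep' : DependsOn f {v | v ∈ A ∨ σ v = σ'' v} := by
    refine hdep.mono fun v hv => ?_
    rcases hv with h | h
    · exact Or.inl h
    · by_cases hvA : v ∈ A
      · exact Or.inl hvA
      · right; simp only [σ'', hvA, if_false]; exact h
  have hdep'' : DependsOn f {v | v ∈ A ∨ σ'' v = σ v} :=
    hdep'.mono fun v hv => hv.imp id Eq.symm
  have h1 := hBL A hA 0 σ σ'' hagree' f hf hf01 hdep'
  have h2 := hBL A hA 0 σ'' σ (fun v hv => (hagree' v hv).symm) f hf hf01 hdep''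
  simp only [zero_mul, Real.exp_zero, one_mul] at h1 h2
  rw [← hker]
  exact le_antisymm h1 h2

end Markov

end Literature.Probability.LatticeModels
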